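import Summits.ABC.StewartYu.PadicTwistPMDescent
import Summits.ABC.StewartYu.PadicTwistPMHalfSeparation
import Summits.ABC.StewartYu.PadicTwistPMExpClass
import Summits.ABC.StewartYu.DescentStepQParts
import HarnessLib

/-!
# Cell abc-stewartyu, WP-Y provider B (xi-b): the half step at `p ≡ 1 (mod 4)` — descent with the ± class,
# the glue theorem `inv_succ_pm`, and the discharge `halfStep_pm_of` of `HalfStepPM`

`Summits/ABC/StewartYu/PadicTwistPMHalfStep.lean` — seat p3 (crux `W80OneModFour` stmt-ABC-19487; memo-05 §3–§4).
STAGED by p3-g2 (kernel-checked inside HOME/p3/lean/pm/CHECK_PM_chain.lean); FILE after PadicTwistPMMain.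
[folklore].
-/

noncomputable section

open NormedSpace Finset IsUltrametricDist
open Literature.NumberTheory.Transcendental
open Literature.NumberTheory.Transcendental.CW77.Setup (Idx Tau tauNorm)
open scoped Nat

namespace Summit.ABC.StewartYu
/-! ## HalfStepPM (provider B), part 5d-iv — THE GLUE THEOREM. -/

namespace TwistSetup

variable {p : ℕ} [Fact p.Prime] (S : TwistSetup p) {h Lb : ℕ}

open Classical in
/-- **Provider B: the half step at `p ≡ 1 (mod 4)`** (glue of parts 3, 4, 5a–5d). From the ± invariant at
level `J` with its sign data `sgn` (extended by `±1` off the support), the twisted coefficients `c = sgn·pv`,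
the exponent data (`ζ` primitive of order `2M`, `ηᵢ = ζ^{rᵢ}`, `k₁(u) = ⌊(∑ rᵢλᵢ(u))/M⌋`), the `ℂ_p` square
roots (`ŝᵢ ξ^{rᵢ} = psqrt(ωᵢ)`, `ξ^M = ι`, `ι² = −1`, `‖ξ‖ = 1`, `ŝᵢ² = allᵢ`, `‖ŝᵢ‖ ≤ 1`), the signed Kummer
condition, and — for every odd `s < 2^{J+1}S₀` and `|τ| < T/2^{J+1}` — denominators/sizes of the two signed
parity class-sum vectors over the support (exponent data `s·k₁`) and the smallness
`‖φ(c)(s/2)‖_p < D/(4D²Mb(∏H(allᵢ))³)^{2^{d+2}}`: the ± invariant at level `J + 1`. [folklore] -/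
theorem inv_succ_pm {J₀ J : ℕ} (hJ : J < J₀) {L : Fin S.d → ℕ} {Lθ S₀ T : ℕ} {P : ℤ}
    {pv : Idx S.d h Lb → ℤ} (inv : S.InvPM J₀ L Lθ S₀ T P J pv)
    (ρ : ℚ_[p]) (sgn c : Idx S.d h Lb → ℤ) (hsgn : ∀ u, sgn u = 1 ∨ sgn u = -1)
    (hcls : ∀ u, pv u ≠ 0 → S.cls u = (sgn u : ℚ_[p]) * ρ) (hc : ∀ u, c u = sgn u * pv u)
    {ζ : ℚ_[p]} {M : ℕ} (hM : 0 < M) (hζ : IsPrimitiveRoot ζ (2 * M)) (r : Fin (S.d + 1) → ℕ)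
    (hη : ∀ i, S.η i = ζ ^ r i) (k₁ : Idx S.d h Lb → ℕ)
    (hk₁ : ∀ u, k₁ u = (∑ i, r i * S.frame.expn u 1 i) / M)
    (ŝ : Fin (S.d + 1) → ℂ_[p]) (ξ ιC : ℂ_[p])
    (hσ : ∀ i, algebraMap ℚ_[p] ℂ_[p] (PadicExp.psqrt (S.ω i)) = ŝ i * ξ ^ r i)
    (hι : ξ ^ M = ιC) (hι2 : ιC ^ 2 = -1) (hξ : ‖ξ‖ = 1)
    (hŝ : ∀ i, ŝ i * ŝ i = (S.toQ.all i : ℂ_[p])) (hŝ1 : ∀ i, ‖ŝ i‖ ≤ 1)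
    (hind : ∀ T : Finset (Fin (S.d + 1)), T.Nonempty →
      ¬ IsSquare (∏ j ∈ T, S.toQ.all j) ∧ ¬ IsSquare (-∏ j ∈ T, S.toQ.all j))
    (D : ℕ → Tau S.d → ℕ) (hD : ∀ s τ, 1 ≤ D s τ) (Mb : ℕ → Tau S.d → ℝ) (hMb : ∀ s τ, 1 ≤ Mb s τ)
    (hden₀ : ∀ s, s < 2 ^ (J + 1) * S₀ → Odd s → ∀ τ : Tau S.d, tauNorm τ < T / 2 ^ (J + 1) →
      ∀ T', ∃ z : ℤ, (D s τ : ℚ) *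
        (∑ u ∈ (((S.toQ.flat.box (h := h) (Lb := Lb) L Lθ J).filter fun u => c u ≠ 0).filter
            fun u => Even (s * k₁ u)) with S.toQ.flat.Sset u s = T',
          (((-1) ^ (s * k₁ u / 2) * c u : ℤ) : ℚ) *
            ((S.frame.qΔ J₀ (J + 1) u τ.1 s * S.frame.qA u τ.2) * S.toQ.qEh u s)) = z)
    (hden₁ : ∀ s, s < 2 ^ (J + 1) * S₀ → Odd s → ∀ τ : Tau S.d, tauNorm τ < T / 2 ^ (J + 1) →
      ∀ T', ∃ z : ℤ, (D s τ : ℚ) *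
        (∑ u ∈ (((S.toQ.flat.box (h := h) (Lb := Lb) L Lθ J).filter fun u => c u ≠ 0).filter
            fun u => ¬ Even (s * k₁ u)) with S.toQ.flat.Sset u s = T',
          (((-1) ^ (s * k₁ u / 2) * c u : ℤ) : ℚ) *
            ((S.frame.qΔ J₀ (J + 1) u τ.1 s * S.frame.qA u τ.2) * S.toQ.qEh u s)) = z)
    (hcM : ∀ s, s < 2 ^ (J + 1) * S₀ → Odd s → ∀ τ : Tau S.d, tauNorm τ < T / 2 ^ (J + 1) →
      ∑ T', |((∑ u ∈ (((S.toQ.flat.box (h := h) (Lb := Lb) L Lθ J).filter fun u => c u ≠ 0).filter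
            fun u => Even (s * k₁ u)) with S.toQ.flat.Sset u s = T',
          (((-1) ^ (s * k₁ u / 2) * c u : ℤ) : ℚ) *
            ((S.frame.qΔ J₀ (J + 1) u τ.1 s * S.frame.qA u τ.2) * S.toQ.qEh u s) : ℚ) : ℝ)| +
      ∑ T', |((∑ u ∈ (((S.toQ.flat.box (h := h) (Lb := Lb) L Lθ J).filter fun u => c u ≠ 0).filter
            fun u => ¬ Even (s * k₁ u)) with S.toQ.flat.Sset u s = T',
          (((-1) ^ (s * k₁ u / 2) * c u : ℤ) : ℚ) *
            ((S.frame.qΔ J₀ (J + 1) u τ.1 s * S.frame.qA u τ.2) * S.toQ.qEh u s) : ℚ) : ℝ)| ≤ Mb s τ)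
    (hlt : ∀ s, s < 2 ^ (J + 1) * S₀ → Odd s → ∀ τ : Tau S.d, tauNorm τ < T / 2 ^ (J + 1) →
      ‖S.Φ J₀ J (S.toQ.flat.box (h := h) (Lb := Lb) L Lθ J) c τ ((2 : ℚ_[p])⁻¹ * (s : ℚ_[p]))‖ <
        (D s τ : ℝ) / (4 * (D s τ : ℝ) ^ 2 * Mb s τ *
          Literature.NumberTheory.Transcendental.CW77.heightProd S.toQ.all ^ 3) ^ (2 ^ (S.d + 1 + 1))) :
    ∃ pv' : Idx S.d h Lb → ℤ, S.InvPM J₀ L Lθ S₀ T P (J + 1) pv' := by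
  classical
  set box := S.toQ.flat.box (h := h) (Lb := Lb) L Lθ J with hbox
  have h2M : 0 < 2 * M := by omega
  have hζM : ζ ^ M = -1 := (hζ.pow h2M (show 2 * M = M * 2 by ring)).eq_neg_one_of_two_right
  have hζ0 : ζ ≠ 0 := hζ.ne_zero (by omega)
  have hcne : ∀ u, c u ≠ 0 ↔ pv u ≠ 0 := by
    intro u; rw [hc]
    constructor
    · intro h1 h0; exact h1 (by rw [h0, mul_zero])
    · intro h0; exact mul_ne_zero (by rcases hsgn u with h1 | h1 <;> simp [h1]) h0
  obtain ⟨u₀, hu₀⟩ := inv.inv.nonzero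
  have hu₀b : u₀ ∈ box := inv.inv.supp u₀ hu₀
  -- the ± class relative to the pivot
  have hpm : ∀ u, pv u ≠ 0 → S.cls u = S.cls u₀ ∨ S.cls u = -S.cls u₀ := by
    intro u h0
    rw [hcls u h0, hcls u₀ hu₀]
    rcases hsgn u with ha | ha <;> rcases hsgn u₀ with hb | hb <;> simp [ha, hb]
  -- exponent classes at `s = 1`
  set c₁ : ℕ := (∑ i, r i * S.frame.expn u₀ 1 i) % M with hc₁
  have hE1 : ∀ u ∈ box, pv u ≠ 0 → ∑ i, r i * S.frame.expn u 1 i = c₁ + k₁ u * M := by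
    intro u hu h0
    have := S.expClass_of_pm hM hζ r hη box pv u₀ (fun u hu h0 => hpm u h0) odd_one u hu h0
    rw [hk₁]; exact this
  have hE1₀ : ∑ i, r i * S.frame.expn u₀ 1 i = c₁ + k₁ u₀ * M := hE1 u₀ hu₀b hu₀
  -- the s-independent sign
  set χ : Idx S.d h Lb → ℤ := fun u => (-1) ^ (k₁ u / 2) * sgn u with hχ
  have hχpm : ∀ u, χ u = 1 ∨ χ u = -1 := by
    intro u
    rcases neg_one_pow_eq_or ℤ (k₁ u / 2) with h1 | h1 <;> rcases hsgn u with h2 | h2 <;>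
      simp [hχ, h1, h2]
  refine S.descent_class_pm' inv χ hχpm u₀ hu₀ ?_
  intro s hs hodd τ hτ
  -- part 3 at the point `s` over the support, exponent data `(s c₁, s k₁)`
  set box' := box.filter fun u => c u ≠ 0 with hbox'
  have hcls' : ∀ u ∈ box', ∑ i, r i * S.frame.expn u s i = s * c₁ + (s * k₁ u) * M := by
    intro u hu
    obtain ⟨hub, hcu⟩ := mem_filter.mp hu
    rw [S.expSum_mul, hE1 u hub ((hcne u).mp hcu)]; ring
  have hlt' := hlt s hs hodd τ hτ
  rw [S.Φ_eq_filter_support] at hlt'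
  obtain ⟨hV0, hV1⟩ := S.classSums_eq_zero_of_norm_Φ_half_lt hJ box' c τ s ŝ ξ ιC r
    (M := M) (c₀ := s * c₁) (fun u => s * k₁ u) hσ hι hι2 hξ hcls' hŝ hŝ1 hind (hD s τ) (hMb s τ)
    (hden₀ s hs hodd τ hτ) (hden₁ s hs hodd τ hτ) (hcM s hs hodd τ hτ) hlt'
  -- part 5c at the point `s` (exponent data `s c₁`, `s k₁`, sign `χ_s`)
  set χs : Idx S.d h Lb → ℤ := fun u => (-1) ^ (s * k₁ u / 2) * sgn u with hχs
  have hEs : ∀ u ∈ box, pv u ≠ 0 → ∑ i, r i * S.frame.expn u s i = s * c₁ + (s * k₁ u) * M := by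
    intro u hu h0; rw [S.expSum_mul, hE1 u hu h0]; ring
  have hEs₀ : ∑ i, r i * S.frame.expn u₀ s i = s * c₁ + (s * k₁ u₀) * M := hEs u₀ hu₀b hu₀
  have h5c := S.classVec_restrict_eq hζM hζ0 r hη J₀ J box pv sgn c χs (fun u => s * k₁ u) u₀ τ
    hodd hc (fun u => rfl) (fun u _ => hsgn u) (fun u _ h0 => hpm u h0) hEs hEs₀
  -- its right-hand side vanishes (part 3)
  have hzero_s : S.toQ.classVec J₀ J box (fun u => if S.cls u = S.cls u₀ then χs u * pv u else 0) τ s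
      = 0 := by
    rw [h5c]
    funext T'
    by_cases hpar₀ : Even (s * k₁ u₀)
    · have hf : ((box.filter fun u => c u ≠ 0).filter fun u => (Even (s * k₁ u) ↔ Even (s * k₁ u₀))) =
          (box.filter fun u => c u ≠ 0).filter fun u => Even (s * k₁ u) :=
        filter_congr fun u _ => iff_true_right hpar₀
      rw [hf]; exact congrFun hV0 T'
    · have hf : ((box.filter fun u => c u ≠ 0).filter fun u => (Even (s * k₁ u) ↔ Even (s * k₁ u₀))) =
          (box.filter fun u => c u ≠ 0).filter fun u => ¬ Even (s * k₁ u) :=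
        filter_congr fun u _ => iff_false_right hpar₀
      rw [hf]; exact congrFun hV1 T'
  -- `χ_s = ε₀ χ` on the sub-class of the pivot (inside the box)
  set ε₀ : ℤ := if Even (k₁ u₀) then 1 else (-1) ^ (s / 2) with hε₀
  have hε₀ne : (ε₀ : ℚ) ≠ 0 := by
    have : ε₀ = 1 ∨ ε₀ = -1 := by
      by_cases he : Even (k₁ u₀)
      · left; simp [hε₀, he]
      · simp only [hε₀, if_neg he]; exact neg_one_pow_eq_or ℤ _
    rcases this with h1 | h1 <;> simp [h1]
  have hterm : ∀ u ∈ box, (if S.cls u = S.cls u₀ then χs u * pv u else 0) =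
      ε₀ * (if S.cls u = S.cls u₀ then χ u * pv u else 0) := by
    intro u hu
    by_cases hcl : S.cls u = S.cls u₀
    · rw [if_pos hcl, if_pos hcl]
      by_cases h0 : pv u = 0
      · simp [h0]
      · have hpar : (Even (k₁ u) ↔ Even (k₁ u₀)) :=
          (S.cls_eq_iff_parity hζM hζ0 r hη odd_one (hE1 u hu h0) hE1₀ (hpm u h0)).mp hcl
        simp only [hχs, hχ, hε₀]
        rw [neg_one_pow_mul_div_two hodd (k₁ u)]
        by_cases he : Even (k₁ u)
        · rw [if_pos he, if_pos (hpar.mp he)]; ring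
        · rw [if_neg he, if_neg (fun h' => he (hpar.mpr h'))]; ring
    · rw [if_neg hcl, if_neg hcl, mul_zero]
  have hcv : S.toQ.classVec J₀ J box (fun u => if S.cls u = S.cls u₀ then χs u * pv u else 0) τ s =
      S.toQ.classVec J₀ J box (fun u => ε₀ * (if S.cls u = S.cls u₀ then χ u * pv u else 0)) τ s := by
    funext T'
    unfold SetupQ.classVec
    refine sum_congr rfl fun u hu => ?_
    dsimp only
    rw [hterm u (mem_filter.mp hu).1]
  rw [hcv, S.classVec_smul] at hzero_s
  funext T'
  have := congrFun hzero_s T'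
  simp only [Pi.zero_apply] at this ⊢
  rcases mul_eq_zero.mp this with h1 | h1
  · exact absurd h1 hε₀ne
  · exact h1

end TwistSetup


/-! ## HalfStepPM (provider B), part 6 — DISCHARGE of the `HalfStep` input of `main` at `p ≡ 1 (mod 4)`:
Schwarz at `s/2` (class-free `norm_Φ_le_of_zeros`, zeros by `Φ_natCast_pm` from the k-chain output) +
ONE numeric inequality per `(s, τ)` + a denominator of `rHalf` and the size `∑_u P·|rHalf u|`. -/

namespace TwistSetup

variable {p : ℕ} [Fact p.Prime] (S : TwistSetup p) {h Lb : ℕ}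

open Classical in
/-- **Provider B discharges `HalfStep`.** [folklore] -/
theorem halfStep_pm_of {J₀ J : ℕ} (hJ : J < J₀) {L : Fin S.d → ℕ} {Lθ S₀ T t : ℕ} {P : ℤ}
    (ht : 1 ≤ t) (hΛ : ‖S.Λ₀‖ ≤ (p : ℝ)⁻¹)
    (hroom : ∀ τ : Tau S.d, tauNorm τ < T / 2 ^ (J + 1) → tauNorm τ + t ≤ T / 2 ^ J - S.d * t)
    {ζ : ℚ_[p]} {M : ℕ} (hM : 0 < M) (hζ : IsPrimitiveRoot ζ (2 * M)) (r : Fin (S.d + 1) → ℕ)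
    (hη : ∀ i, S.η i = ζ ^ r i)
    (ŝ : Fin (S.d + 1) → ℂ_[p]) (ξ ιC : ℂ_[p])
    (hσ : ∀ i, algebraMap ℚ_[p] ℂ_[p] (PadicExp.psqrt (S.ω i)) = ŝ i * ξ ^ r i)
    (hι : ξ ^ M = ιC) (hι2 : ιC ^ 2 = -1) (hξ : ‖ξ‖ = 1)
    (hŝ : ∀ i, ŝ i * ŝ i = (S.toQ.all i : ℂ_[p])) (hŝ1 : ∀ i, ‖ŝ i‖ ≤ 1)
    (hind : ∀ T : Finset (Fin (S.d + 1)), T.Nonempty →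
      ¬ IsSquare (∏ j ∈ T, S.toQ.all j) ∧ ¬ IsSquare (-∏ j ∈ T, S.toQ.all j))
    (D : ℕ → Tau S.d → ℕ) (hD : ∀ s τ, 1 ≤ D s τ) (Rint : ℕ → Tau S.d → Idx S.d h Lb → ℤ)
    (hR : ∀ s (τ : Tau S.d), ∀ u ∈ S.toQ.flat.box (h := h) (Lb := Lb) L Lθ J,
      (D s τ : ℚ) * ((S.frame.qΔ J₀ (J + 1) u τ.1 s * S.frame.qA u τ.2) * S.toQ.qEh u s) = Rint s τ u)
    (Mb : ℕ → Tau S.d → ℝ) (hMb : ∀ s τ, 1 ≤ Mb s τ)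
    (hMbP : ∀ s (τ : Tau S.d), ∑ u ∈ S.toQ.flat.box (h := h) (Lb := Lb) L Lθ J,
      (P : ℝ) * |((S.frame.qΔ J₀ (J + 1) u τ.1 s * S.frame.qA u τ.2 * S.toQ.qEh u s : ℚ) : ℝ)| ≤ Mb s τ)
    (hfinal : ∀ s, s < 2 ^ (J + 1) * S₀ → Odd s → ∀ τ : Tau S.d, tauNorm τ < T / 2 ^ (J + 1) →
      max ((p : ℝ) ^ (h * Lb / (p - 1)) * ‖S.Λ₀‖ * (p : ℝ) ^ ((t - 1) / (p - 1)) *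
            (p : ℝ) ^ PadicCW77.condExp p (2 ^ (S.d + J) * S₀ / 2) t)
          ((p : ℝ) ^ (h * Lb) / Real.sqrt p ^ ((2 ^ (S.d + J) * S₀ / 2) * t)) <
        (D s τ : ℝ) / (4 * (D s τ : ℝ) ^ 2 * Mb s τ *
          Literature.NumberTheory.Transcendental.CW77.heightProd S.toQ.all ^ 3) ^ (2 ^ (S.d + 1 + 1))) :
    S.HalfStepPM (h := h) (Lb := Lb) J₀ J L Lθ S₀ T t P := by
  classical
  intro pv inv hzeros
  set box := S.toQ.flat.box (h := h) (Lb := Lb) L Lθ J with hbox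
  obtain ⟨ρ, sgn, hρG, hsgn, hcls⟩ := inv.cls
  -- extend the sign off the support
  set sgn' : Idx S.d h Lb → ℤ := fun u => if pv u ≠ 0 then sgn u else 1 with hsgn'
  have hsgn'eq : ∀ u, pv u ≠ 0 → sgn' u = sgn u := fun u h0 => by simp [hsgn', h0]
  have hsgn'pm : ∀ u, sgn' u = 1 ∨ sgn' u = -1 := by
    intro u
    by_cases h0 : pv u ≠ 0
    · rw [hsgn'eq u h0]; exact hsgn u h0
    · left; simp [hsgn', h0]
  have hcls' : ∀ u, pv u ≠ 0 → S.cls u = (sgn' u : ℚ_[p]) * ρ := by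
    intro u h0; rw [hsgn'eq u h0]; exact hcls u h0
  set c : Idx S.d h Lb → ℤ := fun u => sgn' u * pv u with hc
  have hcabs : ∀ u, |c u| = |pv u| := by
    intro u; simp only [hc, abs_mul]
    rcases hsgn'pm u with h1 | h1 <;> simp [h1]
  have hP0 : (0 : ℤ) ≤ P := by
    obtain ⟨u₀, hu₀⟩ := inv.inv.nonzero
    exact le_trans (abs_nonneg _) (inv.inv.bound u₀)
  refine S.inv_succ_pm hJ inv ρ sgn' c hsgn'pm hcls' (fun u => rfl) hM hζ r hη
    (fun u => (∑ i, r i * S.frame.expn u 1 i) / M) (fun u => rfl) ŝ ξ ιC hσ hι hι2 hξ hŝ hŝ1 hind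
    D hD Mb hMb ?_ ?_ ?_ ?_
  · -- denominators, even class
    intro s hs hodd τ hτ T'
    refine ⟨∑ u ∈ ((box.filter fun u => c u ≠ 0).filter fun u =>
        Even (s * ((∑ i, r i * S.frame.expn u 1 i) / M))) with S.toQ.flat.Sset u s = T',
      ((-1) ^ (s * ((∑ i, r i * S.frame.expn u 1 i) / M) / 2) * c u) * Rint s τ u, ?_⟩
    rw [mul_sum]
    push_cast
    refine sum_congr rfl fun u hu => ?_
    have hub : u ∈ box := (mem_filter.mp (mem_filter.mp (mem_filter.mp hu).1).1).1
    rw [← hR s τ u hub]; ring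
  · -- denominators, odd class
    intro s hs hodd τ hτ T'
    refine ⟨∑ u ∈ ((box.filter fun u => c u ≠ 0).filter fun u =>
        ¬ Even (s * ((∑ i, r i * S.frame.expn u 1 i) / M))) with S.toQ.flat.Sset u s = T',
      ((-1) ^ (s * ((∑ i, r i * S.frame.expn u 1 i) / M) / 2) * c u) * Rint s τ u, ?_⟩
    rw [mul_sum]
    push_cast
    refine sum_congr rfl fun u hu => ?_
    have hub : u ∈ box := (mem_filter.mp (mem_filter.mp (mem_filter.mp hu).1).1).1
    rw [← hR s τ u hub]; ring
  · -- sizes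
    intro s hs hodd τ hτ
    -- each class: `∑_{T'} |V(T')| ≤ ∑_{u ∈ class} |c u| |R u|`
    have hcls_le : ∀ (B' : Finset (Idx S.d h Lb)), B' ⊆ box →
        ∑ T', |((∑ u ∈ B' with S.toQ.flat.Sset u s = T',
          (((-1) ^ (s * ((∑ i, r i * S.frame.expn u 1 i) / M) / 2) * c u : ℤ) : ℚ) *
            ((S.frame.qΔ J₀ (J + 1) u τ.1 s * S.frame.qA u τ.2) * S.toQ.qEh u s) : ℚ) : ℝ)| ≤
        ∑ u ∈ B', (P : ℝ) *
          |((S.frame.qΔ J₀ (J + 1) u τ.1 s * S.frame.qA u τ.2 * S.toQ.qEh u s : ℚ) : ℝ)| := by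
      intro B' hB'
      calc _ ≤ ∑ T', ∑ u ∈ B' with S.toQ.flat.Sset u s = T',
            |(((((-1) ^ (s * ((∑ i, r i * S.frame.expn u 1 i) / M) / 2) * c u : ℤ) : ℚ) *
              ((S.frame.qΔ J₀ (J + 1) u τ.1 s * S.frame.qA u τ.2) * S.toQ.qEh u s) : ℚ) : ℝ)| := by
            refine sum_le_sum fun T' _ => ?_
            push_cast
            exact abs_sum_le_sum_abs _ _
        _ = ∑ u ∈ B', |(((((-1) ^ (s * ((∑ i, r i * S.frame.expn u 1 i) / M) / 2) * c u : ℤ) : ℚ) *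
              ((S.frame.qΔ J₀ (J + 1) u τ.1 s * S.frame.qA u τ.2) * S.toQ.qEh u s) : ℚ) : ℝ)| :=
            sum_fiberwise B' (fun u => S.toQ.flat.Sset u s) _
        _ ≤ _ := by
            refine sum_le_sum fun u _ => ?_
            push_cast
            rw [abs_mul, abs_mul]
            have h1 : |((-1 : ℝ)) ^ (s * ((∑ i, r i * S.frame.expn u 1 i) / M) / 2)| = 1 := by
              rw [abs_pow, abs_neg, abs_one, one_pow]
            rw [h1, one_mul]
            have h2 : |(c u : ℝ)| ≤ (P : ℝ) := by
              rw [show |(c u : ℝ)| = ((|c u| : ℤ) : ℝ) by push_cast; rfl, hcabs u]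
              exact_mod_cast inv.inv.bound u
            have h3 : ((S.frame.qΔ J₀ (J + 1) u τ.1 s * S.frame.qA u τ.2) * S.toQ.qEh u s : ℝ) =
                ((S.frame.qΔ J₀ (J + 1) u τ.1 s * S.frame.qA u τ.2 * S.toQ.qEh u s : ℚ) : ℝ) := by
              push_cast; ring
            rw [h3]
            exact mul_le_mul_of_nonneg_right h2 (abs_nonneg _)
    set box' := box.filter fun u => c u ≠ 0 with hbox'
    set B₀ := box'.filter fun u => Even (s * ((∑ i, r i * S.frame.expn u 1 i) / M)) with hB₀
    set B₁ := box'.filter fun u => ¬ Even (s * ((∑ i, r i * S.frame.expn u 1 i) / M)) with hB₁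
    have hB₀s : B₀ ⊆ box := (filter_subset _ _).trans (filter_subset _ _)
    have hB₁s : B₁ ⊆ box := (filter_subset _ _).trans (filter_subset _ _)
    have hsplit : ∑ u ∈ B₀, (P : ℝ) *
          |((S.frame.qΔ J₀ (J + 1) u τ.1 s * S.frame.qA u τ.2 * S.toQ.qEh u s : ℚ) : ℝ)| +
        ∑ u ∈ B₁, (P : ℝ) *
          |((S.frame.qΔ J₀ (J + 1) u τ.1 s * S.frame.qA u τ.2 * S.toQ.qEh u s : ℚ) : ℝ)| =
        ∑ u ∈ box', (P : ℝ) *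
          |((S.frame.qΔ J₀ (J + 1) u τ.1 s * S.frame.qA u τ.2 * S.toQ.qEh u s : ℚ) : ℝ)| :=
      sum_filter_add_sum_filter_not _ _ _
    have hsub : ∑ u ∈ box', (P : ℝ) *
          |((S.frame.qΔ J₀ (J + 1) u τ.1 s * S.frame.qA u τ.2 * S.toQ.qEh u s : ℚ) : ℝ)| ≤
        ∑ u ∈ box, (P : ℝ) *
          |((S.frame.qΔ J₀ (J + 1) u τ.1 s * S.frame.qA u τ.2 * S.toQ.qEh u s : ℚ) : ℝ)| := by
      refine sum_le_sum_of_subset_of_nonneg (filter_subset _ _) fun u _ _ => ?_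
      have : (0 : ℝ) ≤ P := by exact_mod_cast hP0
      positivity
    calc _ ≤ ∑ u ∈ B₀, (P : ℝ) *
            |((S.frame.qΔ J₀ (J + 1) u τ.1 s * S.frame.qA u τ.2 * S.toQ.qEh u s : ℚ) : ℝ)| +
          ∑ u ∈ B₁, (P : ℝ) *
            |((S.frame.qΔ J₀ (J + 1) u τ.1 s * S.frame.qA u τ.2 * S.toQ.qEh u s : ℚ) : ℝ)| :=
          add_le_add (hcls_le B₀ hB₀s) (hcls_le B₁ hB₁s)
      _ ≤ Mb s τ := by rw [hsplit]; exact hsub.trans (hMbP s τ)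
  · -- smallness: Schwarz at `s/2`
    intro s hs hodd τ hτ
    have hkpts : ∀ i, i < 2 ^ (S.d + J) * S₀ / 2 → 2 * i + 1 < 2 ^ (S.d + J) * S₀ := by
      intro i hi; omega
    have hzero' : ∀ i < 2 ^ (S.d + J) * S₀ / 2, ∀ τ'' : Tau S.d, tauNorm τ'' < T / 2 ^ J - S.d * t →
        S.Φ J₀ J box c τ'' ((2 * i + 1 : ℕ) : ℚ_[p]) = 0 := by
      intro i hi τ'' hτ''
      have h1 := S.Φ_natCast_pm J₀ J box pv sgn' (fun u _ h0 => hsgn'pm u)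
        (fun u _ h0 => hcls' u h0) τ'' (2 * i + 1) ⟨i, rfl⟩
      simp only [hc]
      rw [h1, hzeros (2 * i + 1) (hkpts i hi) ⟨i, rfl⟩ τ'' hτ'', Rat.cast_zero, mul_zero]
    have hz : ‖(2 : ℚ_[p])⁻¹ * (s : ℚ_[p])‖ ≤ 1 := by
      rw [norm_mul, PadicExp.norm_inv_two_eq_one S.hp3, one_mul]
      exact_mod_cast Padic.norm_int_le_one (p := p) (s : ℤ)
    have hsch := (S.norm_Φ_le_of_zeros J₀ J box c ht hzero' hΛ hz τ (hroom τ hτ)).2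
    exact lt_of_le_of_lt hsch (hfinal s hs hodd τ hτ)

end TwistSetup



end Summit.ABC.StewartYu

end
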